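import Mathlib
import HarnessLib
import HarnessLib.Audit
import Summits.AtomisticToContinuum.Statement
import Literature.Barriers.AtomisticToContinuum.LocalizedPotentialsExcludeLennardJones
import Literature.Geometry.DiscreteGeometry.FejesTothKissingTwelve
import Literature.Geometry.DiscreteGeometry.KissingPatterns
import Literature.MathematicalPhysics.StatisticalMechanics.BarlowStacking
import Literature.MathematicalPhysics.StatisticalMechanics.HaggStacking
import Literature.MathematicalPhysics.StatisticalMechanics.LennardJonesClusters

/-!
Route: BrittleMieDescent

CLOSED (retired) 2026-08-15T13:41:16Z by operator:999:1257524 — reason: not-a-thesis: assembly does not conclude the sub-problem Statement — note: D-0027 §2.1 audit (human 2026-08-15: routes that do not decide the summit are removed): the assembly concludes `Literature.MathematicalPhysics.StatisticalMechanics.Crystallization`, not the sub-problem statement; a NEW conforming route may be opened from the same idea (generated `closes : … → _root_. The file is kept as the record of this route; refuted decls are indexed as negative knowledge (`ledger negatives`).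

# Route BrittleMieDescent — brittle rung and descent — Mie (2p,p) crystallization for p ≥ p₀ by
local Hales at radius 2 + Barlow-truss rigidity, then Lennard-Jones through two constants

Card realised: brittle-rung-mie-descent (absorbing the energy engine E2 of the retired duplicate
brittle-mie-hales-korn). Put Lennard-Jones at
the end p = 6 of the Mie family V_p(r) = r⁻²ᵖ/(2p) − r⁻ᵖ/p (tree: `mieWith (1/(2p)) (1/p) (2p) p`; p
= 6 IS `lennardJones`; well depth 1/(2p),
curvature p at r = 1) and run ONE architecture at every p: (G) LOCAL HALES AT RADIUS 2 — an atom
that is softly twelve-kissed WITH the Hales gap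
(12 neighbours in [a(1−η), a(1+η)], none in (a(1+η), 1.26a)) and whose twelve neighbours are
likewise, has a first shell whose soft contact graph
IS the fcc or hcp pattern graph (η → 0 limits land in Hales's class 𝒱, so Hales2012 Lemmas 9–10
apply; no L12, no kissing-number theorem, no
rate needed); (K) SOFT KISSING a.e. from the energy; (R) BARLOW-TRUSS RIGIDITY — a ground state
whose bond network is Barlow off o(N) atoms
crystallizes exactly (discrete Korn on octet trusses + action–reaction + Hägg domination select
relaxed hcp). It suffices to show
X := X_G ∧ X_K ∧ X_R at p = 6 with the explicit tolerance η = 1/100: X_G = EffectiveLocalHales, X_K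
= LJSoftKissing, X_R = LJBarlowRigidity.
The BRITTLE RUNG — MieRung: ∃ p₀ ∀ p ≥ p₀ both Blanc–Lewin conjuncts for V_p, the first off-lattice
3-D crystallization theorem for a pure pair
potential — is the same chain with (G) in compactness form (SoftLocalHales, provable now from the
vendored Hales facts), (K) = MieSoftKissing and
(R) = BrittleBarlowRigidity (RungAssembly); it validates the engine where sphere packing is exact
and names the only two p-dependent constants of
the descent: the soft-kissing tolerance versus the local-Hales threshold, and first- versus
second-shell coordination pricing (crossover p ∈ (7,8)).
Lean: `EffectiveLocalHales ∧ LJSoftKissing ∧ LJBarlowRigidity`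

## Assembly
Pure bookkeeping: LJSoftKissing gives a scale a and soft kissing (tolerance 1/100) off o(N) atoms;
rescaling by a⁻¹, EffectiveLocalHales gives
every atom all of whose soft neighbours are softly kissed an fcc/hcp shell graph; by the PROVED
`LennardJonesMinimalDistance_holds` a 4a-ball
holds ≤ C atoms, so the atoms whose 4a-ball meets a non-kissed atom are ≤ C′·o(N); this is the
hypothesis of LJBarlowRigidity, whose conclusion is
`Crystallization` (ground states exist by the PROVED `LennardJonesGroundStatesExist_holds`). The
rung composes the same way (RungAssembly).

Rationale: WHY THIS LINE. Every crystallization theorem for realistic potentials descends from the brittle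
(sticky) limit (HeitmannRadin1980, Theil2006, LucaFriesecke2016
"brittle limit"), and the only 3-D theorem, FlatleyTheil2015 (arXiv:1407.0692, Thm 1.1), needs a
three-body term V₃ whose sole role is local
geometry ("Ψ selects ground states which maximize the number of edges in each nearest neighborhood",
§2.1; Conj. 2.2 printed as the route to drop
it). Observation imported from discrete geometry: Hales's proof of Fejes Tóth's conjecture
(Hales2012, arXiv:1209.6043; tree
`Hales2012_contactGraphFccOrHcp`, `isKissingConfig_kissingShell`, `HalesDSP_layerPackings_holds`) is
LOCAL at radius two bonds, which is exactly
the form a defect-sparse energy argument can feed, so V₃ is replaced by a theorem plus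
Bolzano–Weierstrass; the energy side imports geometric
rigidity (FrieseckeJamesMuller2002-type discrete Korn on the tetrahedron–octahedron truss common to
ALL Barlow stackings) and the 1-D Hägg/ANNNI
stacking calculus already in tree (HaggStacking, BarlowStackingEnergy; items 0716/0737). Versus the
open routes (all 2026-08-15):
CrystalKissingRigidity (LJ head-on) needs a linear-rate robust Hales (its rank-2 crux 0758) — here
the local lemma is rate-free with a
combinatorial conclusion, and strain is controlled two-sidedly (0750 has no lower annulus bound);
SteepnessLadderOneCentre climbs the SAME (2q,q)
ladder but by a pointwise one-centre domination inequality with a local transfer (no shell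
classification, no truss rigidity) — the milestone
(its LadderCrystallizes, item 3624) and the ground-state item 3623 are filed here with identical
text so that they are SHARED, two engines
under one milestone; TwoCentreKissing makes the opposite trade at the local step (gap-FREE
two-centre kernel = Flatley–Theil's open Conj. 2.2
at tolerance 10⁻³, energy side without annulus) where this route keeps Hales's gap (kernel = theorem
+ compactness, tolerance 10⁻²) and pays
for the annulus on the energy side; MieLadderVdwKissing is a different ladder ((n,6): wall softness,
full r⁻⁶ tail). The target is a THEOREM
for the Mie family first with LJ reached by continuation in p through two named constants; negatives
index empty at filing.

RANKED CRUXES. #2 BrittleBarlowRigidity (crux) — BARLOW-TRUSS RIGIDITY, brittle regime (card B4 + E2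
of brittle-mie-hales-korn): there are η₁ > 0 and p₁ such that for every p ≥ p₁, if V_p has ground
states for all N and along every ground-state sequence all but o(N) atoms i have a 4-ball (distances
≤ 4 from x_i) in which EVERY atom is softly twelve-kissed at scale 1 with tolerance η₁ and gap 1.26
AND has an fcc- or hcp-pattern soft contact graph on its shell, then HasPeriodicGroundStateEnergy
V_p 3 ∧ IsCrystallizing V_p 3. Engine: the bond network off the defect set is a bounded-strain
realisation of a Barlow (tetrahedron–octahedron) truss; cell-wise rigidity + FJM give a discrete
Korn inequality uniform in the Hägg word; expanding Σ V_p around the relaxed stacking, the linear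
term is a boundary functional of balanced internal forces (action–reaction, exponentially small in
p), so E ≥ N e(hcp_p*) + c·#defects + gap·(fault area) − C N^(2/3); with the trial bound E(N) ≤ N
e(hcp_p*) + C N^(2/3) this gives vanishing strain, ≤ K fault planes, hcp windows
(CrystallizationLocalLimit bookkeeping) and attainment of the periodic minimum by relaxed hcp (Hägg
domination 0737 with J₂(p) < 0). [difficulty: XL] (why it might fail: Stacking must be resolved
inside finite ground states at scale |J2(p)| ~ 1.63^-p/p against elastic and surface noise; needs a
discrete Korn constant for Barlow trusses uniform in the Hägg word plus an action-reaction surface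
estimate, both unproved; twinned finite-N minimisers (CKL 2023) stress it.) [FlatleyTheil2015,
Theil2006, FrieseckeJamesMuller2002, arXiv:2204.12892, PartayOrtnerCsanyi2017,
stmt-AtomisticToContinuum-0737]
#3 MieSoftKissing (crux) — SOFT KISSING IN THE BRITTLE LIMIT (card B1 = K1_p): for every tolerance η
∈ (0, 1/100] there is p₀ such that for all p ≥ p₀, along every sequence of ground states of V_p the
fraction of atoms that are NOT [at distance ≥ 1−η from every other atom, with exactly twelve others
within 1+η and none at distance in (1+η, 1.26)] tends to 0. Inputs: Flyspeck L12 (soft coordination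
cap, tree `flyspeck_L12`) or Musin–Tarasov (13 spheres) for the count, tail bounds Σ_(r≥1.2)|V_p| =
O(1.2⁻ᵖ/p), relaxed-hcp trial energy; the o(N) conclusion is where a V₃-free coercive estimate is
needed. [difficulty: XL] (why it might fail: o(N) is not bond counting: the tail budget leaves a
defect DENSITY ~1.26^-p, so o(N) needs a coercive Theil-type bound without V3; 13-14-coordinated
stretched motifs stay competitive at first-shell level until p ~ 8 and with outer neighbours until p
~ 40, so p0 may be huge.) [Hales2012, MusinTarasov2012, FlatleyTheil2015, arXiv:1605.00034,
BlancLewin2015]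
#4 LJBarlowRigidity (crux) — BARLOW-TRUSS RIGIDITY AT p = 6 (the descent end of crux 2, explicit
constants): if for some scale a > 0, along every sequence of Lennard-Jones ground states, all but
o(N) atoms have a 4a-ball in which every atom is softly twelve-kissed at scale a with tolerance
1/100 and gap 1.26a and has an fcc/hcp-pattern soft contact graph on its shell, then Crystallization
(both conjuncts for `lennardJones`). Same engine as crux 2 with the LJ numbers: J₂ ≈ −7.3e−5 < 0
with Hägg margin ≈ 250–450 (route CrystalKissingRigidity numerics; certified J_k are item 0670),
octet-truss Korn constant versus the r⁻⁶ tail Hessian. [deps: BrittleBarlowRigidity] [difficulty: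
open-problem] (why it might fail: p = 6 is not brittle: at bond spread 1/100 the elastic noise per
atom (~3e-4) exceeds the stacking gap |J2| ~ 7e-5, so the proof must self-improve the strain to
<~1e-3 a.e. first; the r^-6 tail is outside every localized class
(LocalizedPotentialsExcludeLennardJones).) [FlatleyTheil2015, FrieseckeJamesMuller2002,
PartayOrtnerCsanyi2017, Stillinger2001,
Literature.Barriers.AtomisticToContinuum.ShortRangeStackingBlindness,
stmt-AtomisticToContinuum-0737]
#5 LJSoftKissing (crux) — LJ SOFT KISSING WITH TWO-SIDED STRAIN CONTROL (card B5(a), the p = 6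
constant K1_6): there is a scale a > 0 such that along every sequence of Lennard-Jones ground states
the fraction of atoms NOT [at distance ≥ 0.99a from all others, exactly twelve within 1.01a, none in
(1.01a, 1.26a)] tends to 0. Stronger than the sibling item 0750 (which has no lower annulus bound,
hence no strain control); mechanism: second-shell pricing (card link-census-gauss-bonnet-3d) since
one-shell accounting fails at p = 6, plus elastic decay away from the o(N) defects and the N^(−1/3)
Laplace strain. [difficulty: open-problem] (why it might fail: Needs second-shell pricing: at p = 6
a 13-shell at the Tammes radius 1.0455 beats 12 contacts at first-shell level (13 x 0.0788 > 1); and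
the 1/100 spread must exceed the relaxed-hcp nearest-neighbour split (estimated 1-3e-3, uncertified)
or the statement fails at every bulk atom.) [stmt-AtomisticToContinuum-0750, Hales2012,
BlancLewin2015, Literature.Barriers.AtomisticToContinuum.IcosahedralClusters, Stillinger2001]
#6 EffectiveLocalHales (crux) — EFFECTIVE LOCAL HALES AT RADIUS 2 (card B5(b), the p = 6 constant
η₀; pure metric geometry, scale 1): if u ∈ S ⊂ ℝ³ and every point of S within 1.01 of u (u and its
soft neighbours) is softly twelve-kissed with tolerance 1/100 (all other points at distance ≥ 0.99,
exactly twelve within 1.01, none in (1.01, 1.26)), then the soft contact graph (pairs within 1.01)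
on the twelve neighbours of u is isomorphic to the contact graph of the fcc pattern or of the hcp
pattern (tree `fccKissingPattern`/`hcpKissingPattern`, contacts at distance 1). The η → 0 version is
SoftLocalHales (support, compactness); this is its effectivisation at η = 1/100, a semialgebraic
statement checkable Flyspeck-style by mining the margins of Hales's Lemma 9 exclusions and of Lemma
10's rigidity (tree KissingRigidity.lean, TameContactGraphs.lean). [difficulty: L] (why it might
fail: The threshold 1/100 is a bet: centred fcc/hcp shells flex at second order (jitterbug), and
12-point configurations with tolerance 1/100 but another contact graph may exist inside the slack of
Hales's LP exclusions (Lemma 9) and of 2h0 = 2.52; Böröczky-Szabó eps-quasi-twelve constructions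
unread.) [Hales2012, KusnerKusnerLagariasShlosman2018, BoroczkySzabo2016,
doi:10.1016/j.cam.2013.03.036, Literature.Barriers.AtomisticToContinuum.FlexibleKissingArrangements]
#9 SoftLocalHales (support) — SOFT LOCAL HALES BY COMPACTNESS (card B2+(3); provable now): assuming
the vendored computer-assisted fact `Hales2012_contactGraphFccOrHcp` (Hales 2012 Thm 3 + Lemma 9, in
graph form), there is η₀ > 0 such that for all η ≤ η₀ the conclusion of EffectiveLocalHales holds
with 1/100 replaced by η. Proof sketch: counterexamples with η_n → 0 have boundedly many points
within 2.3 of u (packing); extract a convergent subsequence; by the GAP hypothesis at u and at its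
neighbours the limit shell, doubled, is in Hales's class 𝒱 (`IsKissingConfig`: twelve points on
S²(2), mutual distances 2 or ≥ 2.52) — no L12 and no kissing-number theorem are needed — so its
contact graph is fcc/hcp, and soft contact graphs are eventually constant along the sequence.
[difficulty: provable-now] [Hales2012, FlatleyTheil2015]
#9 SoftLayerPropagation (support) — SOFT LAYER PROPAGATION (qualitative local form of the PROVED
`HalesDSP_layerPackings_holds`): for every R ≥ 4 and δ > 0 there is η > 0 such that if every point
of S in the R-ball about c is softly twelve-kissed (tolerance η, gap 1.26) with an fcc/hcp soft
contact graph, then S in the R/2-ball is δ-close to a rigid-motion image of a Barlow stacking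
`barlowStacking 1 √(2/3) s`, `IsHaggSeq s`. By compactness from the exact local statement
(LayerPropagation/LayerStackings.lean arguments are local). The effective octet-truss version rides
with the rigidity cruxes (`--supports`). [difficulty: M] [HalesDSP2012, Hales2012]
#9 LadderGroundStates (support) — GROUND STATES ON THE (2q,q) LADDER EXIST AND ARE (1 −
2/q)-SEPARATED for q ≥ q₀ — filed with the SAME text as route SteepnessLadderOneCentre's item
stmt-AtomisticToContinuum-3623 so that the item is shared (Blanc–Lewin §1.2 binding criterion as in
the tree's `LennardJonesGroundStatesExist_holds`; Xue/Blanc removal-plus-packing as in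
`LennardJonesMinimalDistance_holds`). RungAssembly consumes existence and separation from it (any δ
> 0 would do; the explicit 1 − 2/q is the sibling route's need). [difficulty: M] [BlancLewin2015,
stmt-AtomisticToContinuum-3623, LennardJonesClusters.lean]
#9 MieRung (support) — THE BRITTLE RUNG (milestone; card headline): there is q₀ such that for all q
≥ q₀, HasPeriodicGroundStateEnergy V_q 3 ∧ IsCrystallizing V_q 3 — both Blanc–Lewin conjuncts for
the Mie (2q,q) potential in ℝ³, Flatley–Theil without V₃ (conclusion relaxed hcp). Filed with the
SAME text as route SteepnessLadderOneCentre's LadderCrystallizes (stmt-AtomisticToContinuum-3624):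
one shared milestone, two engines (their one-centre domination inequality with a local transfer
versus this route's radius-2 Hales kernel + Barlow-truss rigidity). Closed here by RungAssembly; not
on the summit assembly. [difficulty: open-problem] [FlatleyTheil2015, BlancLewin2015,
stmt-AtomisticToContinuum-3624, arXiv:2204.12892, arXiv:2604.19239]
#9 RungAssembly (support) — glue for the rung, `SoftLocalHales → Hales2012_contactGraphFccOrHcp →
LadderGroundStates → MieSoftKissing → BrittleBarlowRigidity → MieRung`: SoftLocalHales gives η₀
under the Hales fact; take η = min(η₀, η₁, 1/100); MieSoftKissing gives p₀(η); soft kissing is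
monotone in the tolerance below the gap; atoms whose 7-ball contains a non-kissed atom number ≤
C·#(non-kissed) by packing (separation from LadderGroundStates), hence o(N); SoftLocalHales supplies
the shell graphs; BrittleBarlowRigidity applies for p ≥ max(p₀(η), p₁, q₀) with existence from
LadderGroundStates. [difficulty: provable-now] [Hales2012, FlatleyTheil2015]

TWO-LAYER PLAN. Foreseen glued splits (k ≤ 3, depth 1), filed only when a crux closes or a prover
proposes: BrittleBarlowRigidity ⇐ BarlowTrussKorn (discrete
Korn uniform in the Hägg word) → ActionReactionSurface (linear term is a boundary functional,
O(1.4⁻²ᵖ·|∂|)) → HaggFaultSelection (0737-type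
domination with boundary term ⇒ ≤ K faults, relaxed hcp attains the periodic minimum);
MieSoftKissing ⇐ MieBondCount (≤ 12 in the well + gap
from L12, defect density O(1.26⁻ᵖ)) → MieCoercivity (defects cost ≥ c/p against the sharp constant);
LJSoftKissing ⇐ SecondShellPriceList
(card link-census-gauss-bonnet-3d) → LJStrainDecay. EffectiveLocalHales ⇐ margin mining of Lemma 9
LPs → second-order rigidity constant of the
centred cuboctahedron / anticuboctahedron.

KILL CRITERIA. EffectiveLocalHales refuted by an explicit 1/100-tolerance configuration with a
non-fcc/hcp shell graph: restate at the witnessed threshold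
(1/300, 1/1000) IF LJSoftKissing survives there, else the descent is dead and the route shrinks to
the rung (close `refuted:EffectiveLocalHales`
if no tolerance above the hcp bond split survives). LJSoftKissing refuted (positive fraction of LJ
bulk atoms not 12-kissed at 1 %, e.g.
certified numerics of icosahedral/Frank–Kasper order in large LJ minimisers, or a relaxed-hcp bond
split > 1/100): every sphere-packing-heritage
LJ route dies with it; keep the rung. MieSoftKissing refuted for all p (13/14-coordinated bulk
phases beating hcp_p at arbitrarily large p):
close the route. BrittleBarlowRigidity refuted (a Barlow-ordered Mie ground-state sequence with
non-vanishing fault density or an aperiodic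
optimal stacking, i.e. Hägg domination failing for V_p): pivot to fcc/hcp-agnostic IsCrystallizing
via thick fault-free slabs, or close.
SoftLocalHales is a theorem modulo the Hales facts; if its Lean proof exposes that Theorem 3's
tameness needs more than membership in 𝒱,
the card's B2 fails and the whole line rests on Flatley–Theil's open Conjecture 2.2 — close as
`refuted:SoftLocalHales` unless 2.2 is adopted
as an explicit conditional. Crystallization proved by CrystalKissingRigidity moots the LJ end, not
the rung.

NOT DECOMPOSED YET. The value of p₀ and of η₁; the discrete Korn constant and its uniformity in the
Hägg word; the action–reaction surface estimate; relaxed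
stackings (non-ideal c/a, two bond lengths) and the sign/size of J₂(p) analytically (Poisson–Bessel
card) versus certified (0670-type); the
Wulff/N^(2/3) constants; rotations of fault planes; the periodic-competitor (torus) version of the
rigidity engine; the second-shell price list
at p = 6. All are layer-2 children of cruxes 2–5 and wait for SoftLocalHales / EffectiveLocalHales
to land first (cheap, decisive).

CHEAPEST FALSIFIER. (1) Lattice sums, minutes of kit time (socket absent this session, not run):
relax LJ hcp in (a, c) and read off the nearest-neighbour split
s_LJ; if s_LJ > 1/100 LJSoftKissing is false as filed (restate at 2·s_LJ and re-examine
EffectiveLocalHales there). (2) A numerical sweep of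
the centred cuboctahedron/anticuboctahedron bar frameworks with bars in [0.99, 1.01] and non-bars ≥
1.26: largest excursion and whether any
other contact graph is reachable — kills or supports EffectiveLocalHales. (3) Reading exercise
(refuter-12's advice): confirm in
arXiv:1209.6043 §§2–4 that Theorem 3 uses only V ∈ 𝒱 — the tree's `Hales2012_contactGraphFccOrHcp`
is already stated for all of 𝒱, so
SoftLocalHales should close in one prover session; if it does not, see Kill criteria.

NUMBERS. V_p(1) = −1/(2p), V_p''(1) = p; Hales h₀ = 1.26 (gap radius 63/50 at unit scale);
first-shell 13-vs-12 crossover p ∈ (7, 8) (13·V_p(1.0455)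
vs 12·V_p(1): −0.5120 vs −0.5000 at p = 6, −0.3698 vs −0.3750 at p = 8; card); J₂(p) < 0 for p ∈ [5,
30] with Hägg domination ratio 311 (p=5),
447 (6), 811 (8), 2.4e3 (12), 2.4e4 (20), 6e5 (30) (card's layer sums, uncertified); LJ: J₂ ≈
−7.3e−5, bulk bond 0.971, second shell 1.373
(route CrystalKissingRigidity); LJ minimal distance δ = 1/3 (tree). Tolerances filed: η = 1/100,
radius 4 (resp. 4a). Items at open: 11
(5 cruxes, 5 support of which 2 shared with SteepnessLadderOneCentre, 1 assembly; no separate target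
decl: X is the conjunction of the three
LJ-end cruxes, frames X and X → Statement are the Assembly).

DEFINITION REQUESTS. None at open: `mieWith`, `fccKissingPattern`/`hcpKissingPattern`,
`barlowStacking`, `IsHaggSeq`, `Hales2012_contactGraphFccOrHcp`,
`IsGroundState`, `HasPeriodicGroundStateEnergy`, `IsCrystallizing`, `lennardJones`,
`Crystallization` all exist (lean search --decl). A named
Literature def `miePotential p := mieWith (1/(2p)) (1/p) (2p) p` with `miePotential 6 =
lennardJones` would shorten every signature — wanted
as a definition item after open (topic Literature/MathematicalPhysics/StatisticalMechanics).

Novelty: Searches (2026-08-15): `lit frontier AtomisticToContinuum --since 2021` (30 rows; crystallization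
rows: none 3-D off-lattice); `lit bridges
AtomisticToContinuum --cross any`; `lit search --source zbmath "crystallization three dimensions"
--year-from 2010` (12: Mainini–Stefanelli 2014
carbon, Farmer–Esedoglu–Smereka 2017 Brenner, FTTT 2013 doi:10.1016/j.cam.2013.03.036,
Friedrich–Kreutz–Stefanelli arXiv:2509.05642 on-lattice);
`lit search --source crossref "face-centered cubic crystallization atomistic configurations pair
potential without three-body"` (1 relevant:
FlatleyTheil2015); `lit search --hybrid "Lennard-Jones hcp fcc lattice sums c/a"`
(BeterminSamajTravenec2022, CKL 2023); openalex/arXiv/S2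
rate-limited, galaxy saturated (logged); plus the card's audit by refuter-12 (65 works citing
arXiv:1407.0692 checked: none removes V₃ or
proves Conj. 2.2; Kreutz–Ziereis arXiv:2604.19239 and CKL arXiv:2204.12892 status quotes "limited to
two dimensions").
Nearest prior art found: FlatleyTheil2015 (arXiv:1407.0692: 3-D fcc crystallization WITH V₃; Def.
2.1 contains rescaled Mie for large p;
Conj. 2.2; Prop. 3.3 robust local form by compactness from Thm 3.4/3.5) and Hales2012
(arXiv:1209.6043, exact kissing-twelve classification;
tree FejesTothKissingTwelve.lean); 2-D template Theil2006; brittle limit named in LucaFriesecke2016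
(arXiv:1605.00034).
Delta: Flatley–Theil's programme with V₃ replaced by Hales 2012 read locally at radius two (a
theorem + compactness instead of their op  [refs: 10.1016/j.cam.2013.03.036, 2509.05642, 1407.0692, 2604.19239, 2204.12892, 1209.6043, 1605.00034, doi:10.1016/j.cam.2013.03.036, FlatleyTheil2015, BeterminSamajTravenec2022, Hales2012, Theil2006, LucaFriesecke2016]

Barriers (technique_class: brittle-limit-continuation, local-hales, barlow-truss): - technique_class: brittle-limit-continuation, local-hales, barlow-truss
- Literature.Barriers.AtomisticToContinuum.LocalizedPotentialsExcludeLennardJones: APPLIES and is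
embraced — p = 6 is outside Theil's and Flatley–Theil's classes (`not_isLocalizedPair_mieWith` even
for all q < 8), so no localized-class theorem is instantiated at p = 6; the rung is proved where the
class conditions hold (q = p ≥ 8 passes the r⁻¹⁰ decay test) and LJ is reached only through the
explicit cruxes LJSoftKissing / LJBarlowRigidity / EffectiveLocalHales.
- Literature.Barriers.AtomisticToContinuum.FlexibleKissingArrangements: APPLIES to any single-shell
inference; evaded because the local lemma uses u AND its twelve neighbours with the Hales gap
(radius 2), under which the icosahedral witness (shell–shell distance 1.0515 ∈ gap) is not
admissible and the conclusion is the rigid contact GRAPH, not a metric rate; the residual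
second-order flex (jitterbug) is exactly the declared risk of EffectiveLocalHales.
- Literature.Barriers.AtomisticToContinuum.KissingTwelveDegeneracy: APPLIES (twelve contacts never
select the stacking); evaded as in its evasions (ii)/(iv): the geometry concludes only "Barlow off
o(N)", and the stacking is selected inside the rigidity cruxes by the pair tail through J₂(p) < 0
with Hägg domination (0737), uniformly along the descent.
- Literature.Barriers.AtomisticToContinuum.ShortRangeStackingBlindness: the tail is never truncated;
J₂ lives at height 2h for every p and enters th

History (route lifecycle, newest last):
- 2026-08-15T13:32:01Z · BROKEN — EffectiveLocalHales (stmt-AtomisticToContinuum-4146, crux) refuted by Summit.AtomisticToContinuum.Crystallization.Theorems.BrittleMieDescentEffectiveLocalHales_refuted @ 002241d41fff (refuter-refute-pool-g42-18)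
- 2026-08-15T13:41:16Z · CLOSED retired — not-a-thesis: assembly does not conclude the sub-problem Statement (operator:999:1257524)

sub-problem: Crystallization · status: closed(retired) · opened planner-plancard-AtomisticToContinuum-Crystal-007228c5-0 2026-08-15T11:28:25Z · rev 0 · ledger route-AtomisticToContinuum-BrittleMieDescent
GENERATED by the gate from the ledger (D-0016/17). Provers cite these decls: `theorem foo : Summit.AtomisticToContinuum.Crystallization.Theses.BrittleMieDescent.<Decl> := …` in Summits/AtomisticToContinuum/Crystallization/Theorems/<Name>.lean.
-/

namespace Summit.AtomisticToContinuum.Crystallization.Theses.BrittleMieDescent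

open scoped BigOperators Topology Manifold Classical MeasureTheory ProbabilityTheory Matrix InnerProductSpace ComplexConjugate ContinuousMap
open Filter Set Function TopologicalSpace MeasureTheory

attribute [summit_statement] _root_.Crystallization

/-- item stmt-AtomisticToContinuum-4142 · crux · rank 2 · closed · moot by None · by planner
why it might fail: Stacking must be resolved inside finite ground states at scale |J2(p)| ~ 1.63^-p/p against elastic and surface noise; needs a discrete Korn constant for Barlow trusses uniform in the Hägg word plus an action-reaction surface estimate, both unproved; twinned finite-N minimisers (CKL 2023) stress it.
sources: FlatleyTheil2015, Theil2006, FrieseckeJamesMuller2002, arXiv:2204.12892, PartayOrtnerCsanyi2017, stmt-AtomisticToContinuum-0737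
[crux] BARLOW-TRUSS RIGIDITY, brittle regime (card B4 + E2 of brittle-mie-hales-korn): there are η₁
> 0 and p₁ such that for every p ≥ p₁, if V_p has ground states for all N and along every
ground-state sequence all but o(N) atoms i have a 4-ball (distances ≤ 4 from x_i) in which EVERY
atom is softly twelve-kissed at scale 1 with tolerance η₁ and gap 1.26 AND has an fcc- or
hcp-pattern soft contact graph on its shell, then HasPeriodicGroundStateEnergy V_p 3 ∧
IsCrystallizing V_p 3. Engine: the bond network off the defect set is a bounded-strain realisation
of a Barlow (tetrahedron–octahedron) truss; cell-wise rigidity + FJM give a discrete Korn inequality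
uniform in the Hägg word; expanding Σ V_p around the relaxed stacking, the linear term is a boundary
functional of balanced internal forces (action–reaction, exponentially small in p), so E ≥ N
e(hcp_p*) + c·#defects + gap·(fault area) − C N^(2/3); with the trial bound E(N) ≤ N e(hcp_p*) + C
N^(2/3) this gives vanishing strain, ≤ K fault planes, hcp windows (CrystallizationLocalLimit
bookkeeping) and attainment of the periodic minimum by relaxed hcp (Hägg domination 0737 with J₂(p)
< 0). [difficulty: XL] -/
@[route_item "route-AtomisticToContinuum-BrittleMieDescent"]
def BrittleBarlowRigidity : Prop :=
  ∃ η₁ : ℝ, 0 < η₁ ∧ ∃ p₁ : ℕ, ∀ p : ℕ, p₁ ≤ p → (∀ N : ℕ, ∃ y : Fin N → EuclideanSpace ℝ (Fin 3), Literature.MathematicalPhysics.StatisticalMechanics.IsGroundState (Literature.Barriers.AtomisticToContinuum.mieWith (1 / (2 * (p : ℝ))) (1 / (p : ℝ)) (2 * p) p) y) → (∀ x : (N : ℕ) → (Fin N → EuclideanSpace ℝ (Fin 3)), (∀ N, Literature.MathematicalPhysics.StatisticalMechanics.IsGroundState (Literature.Barriers.AtomisticToContinuum.mieWith (1 / (2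 * (p : ℝ))) (1 / (p : ℝ)) (2 * p) p) (x N)) → Filter.Tendsto (fun N : ℕ => (Nat.card {i : Fin N // ¬ ∀ j : Fin N, dist (x N i) (x N j) ≤ 4 → (((∀ l : Fin N, l ≠ j → (1 - η₁) ≤ dist (x N j) (x N l) ∧ (dist (x N j) (x N l) ≤ (1 + η₁) ∨ 63 / 50 ≤ dist (x N j) (x N l))) ∧ Nat.card {l : Fin N // l ≠ j ∧ dist (x N j) (x N l) ≤ (1 + η₁)} = 12) ∧ ((∃ e : {k : Fin N // k ≠ j ∧ dist (x N j) (x N k) ≤ (1 + η₁)} ≃ {q : EuclideanSpace ℝ (Fin 3) // q ∈ Literature.Geometry.DiscreteGeometry.fccKissingPattern}, ∀ k k' : {k : Fin N // k ≠ j ∧ dist (x N j) (x N k) ≤ (1 + η₁)}, k ≠ k' → (dist (x N k.1) (x N k'.1) ≤ (1 + η₁) ↔ dist (e k).1 (e k').1 = 1)) ∨ (∃ e : {k : Fin N // k ≠ j ∧ dist (x N j) (x N k) ≤ (1 + η₁)} ≃ {q : EuclideanSpace ℝ (Fin 3) // q ∈ Literature.Geometry.DiscreteGeometry.hcpKissingPattern},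 ∀ k k' : {k : Fin N // k ≠ j ∧ dist (x N j) (x N k) ≤ (1 + η₁)}, k ≠ k' → (dist (x N k.1) (x N k'.1) ≤ (1 + η₁) ↔ dist (e k).1 (e k').1 = 1))))} : ℝ) / N) Filter.atTop (nhds 0)) → Literature.MathematicalPhysics.StatisticalMechanics.HasPeriodicGroundStateEnergy (Literature.Barriers.AtomisticToContinuum.mieWith (1 / (2 * (p : ℝ))) (1 / (p : ℝ)) (2 * p) p) 3 ∧ Literature.MathematicalPhysics.StatisticalMechanics.IsCrystallizing (Literature.Barriers.AtomisticToContinuum.mieWith (1 / (2 * (p : ℝ))) (1 / (p : ℝ)) (2 * p) p) 3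

/-- item stmt-AtomisticToContinuum-4143 · crux · rank 3 · closed · moot by None · by planner
why it might fail: o(N) is not bond counting: the tail budget leaves a defect DENSITY ~1.26^-p, so o(N) needs a coercive Theil-type bound without V3; 13-14-coordinated stretched motifs stay competitive at first-shell level until p ~ 8 and with outer neighbours until p ~ 40, so p0 may be huge.
sources: Hales2012, MusinTarasov2012, FlatleyTheil2015, arXiv:1605.00034, BlancLewin2015
[crux] SOFT KISSING IN THE BRITTLE LIMIT (card B1 = K1_p): for every tolerance η ∈ (0, 1/100] there
is p₀ such that for all p ≥ p₀, along every sequence of ground states of V_p the fraction of atoms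
that are NOT [at distance ≥ 1−η from every other atom, with exactly twelve others within 1+η and
none at distance in (1+η, 1.26)] tends to 0. Inputs: Flyspeck L12 (soft coordination cap, tree
`flyspeck_L12`) or Musin–Tarasov (13 spheres) for the count, tail bounds Σ_(r≥1.2)|V_p| =
O(1.2⁻ᵖ/p), relaxed-hcp trial energy; the o(N) conclusion is where a V₃-free coercive estimate is
needed. [difficulty: XL] -/
@[route_item "route-AtomisticToContinuum-BrittleMieDescent"]
def MieSoftKissing : Prop :=
  ∀ η : ℝ, 0 < η → η ≤ 1 / 100 → ∃ p₀ : ℕ, ∀ p : ℕ, p₀ ≤ p → ∀ x : (N : ℕ) → (Fin N → EuclideanSpace ℝ (Fin 3)), (∀ N, Literature.MathematicalPhysics.StatisticalMechanics.IsGroundState (Literature.Barriers.AtomisticToContinuum.mieWith (1 / (2 * (p : ℝ))) (1 / (p : ℝ)) (2 * p) p) (x N)) → Filter.Tendsto (fun N : ℕ => (Nat.card {i : Fin N // ¬ ((∀ j : Fin N, j ≠ i → (1 - η) ≤ dist (x N i) (x N j) ∧ (dist (x N i) (x N j) ≤ (1 + η) ∨ 63 / 50 ≤ dist (x N i) (x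 N j))) ∧ Nat.card {j : Fin N // j ≠ i ∧ dist (x N i) (x N j) ≤ (1 + η)} = 12)} : ℝ) / N) Filter.atTop (nhds 0)

/-- item stmt-AtomisticToContinuum-4144 · crux · rank 4 · closed · moot by None · by planner
why it might fail: p = 6 is not brittle: at bond spread 1/100 the elastic noise per atom (~3e-4) exceeds the stacking gap |J2| ~ 7e-5, so the proof must self-improve the strain to <~1e-3 a.e. first; the r^-6 tail is outside every localized class (LocalizedPotentialsExcludeLennardJones).
sources: FlatleyTheil2015, FrieseckeJamesMuller2002, PartayOrtnerCsanyi2017, Stillinger2001, Literature.Barriers.AtomisticToContinuum.ShortRangeStackingBlindness, stmt-AtomisticToContinuum-0737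
[crux] BARLOW-TRUSS RIGIDITY AT p = 6 (the descent end of crux 2, explicit constants): if for some
scale a > 0, along every sequence of Lennard-Jones ground states, all but o(N) atoms have a 4a-ball
in which every atom is softly twelve-kissed at scale a with tolerance 1/100 and gap 1.26a and has an
fcc/hcp-pattern soft contact graph on its shell, then Crystallization (both conjuncts for
`lennardJones`). Same engine as crux 2 with the LJ numbers: J₂ ≈ −7.3e−5 < 0 with Hägg margin ≈
250–450 (route CrystalKissingRigidity numerics; certified J_k are item 0670), octet-truss Korn
constant versus the r⁻⁶ tail Hessian. [deps: BrittleBarlowRigidity] [difficulty: open-problem] -/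
@[route_item "route-AtomisticToContinuum-BrittleMieDescent"]
def LJBarlowRigidity : Prop :=
  (∃ a : ℝ, 0 < a ∧ ∀ x : (N : ℕ) → (Fin N → EuclideanSpace ℝ (Fin 3)), (∀ N, Literature.MathematicalPhysics.StatisticalMechanics.IsGroundState Literature.MathematicalPhysics.StatisticalMechanics.lennardJones (x N)) → Filter.Tendsto (fun N : ℕ => (Nat.card {i : Fin N // ¬ ∀ j : Fin N, dist (x N i) (x N j) ≤ 4 * a → (((∀ l : Fin N, l ≠ j → a * (1 - 1 / 100) ≤ dist (x N j) (x N l) ∧ (dist (x N j) (x N l) ≤ a * (1 + 1 / 100) ∨ 63 / 50 * a ≤ dist (x N j) (x N l))) ∧ Nat.card {l : Fin N // l ≠ j ∧ dist (x N j) (x N l) ≤ a * (1 + 1 / 100)} = 12) ∧ ((∃ e : {k : Fin N // k ≠ j ∧ dist (x N j) (x N k) ≤ a * (1 + 1 / 100)} ≃ {q : EuclideanSpace ℝ (Fin 3) // q ∈ Literature.Geometry.DiscreteGeometry.fccKissingPattern}, ∀ k k' : {k : Fin N // k ≠ j ∧ dist (x N j) (x N k) ≤ a * (1 + 1 / 100)},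 k ≠ k' → (dist (x N k.1) (x N k'.1) ≤ a * (1 + 1 / 100) ↔ dist (e k).1 (e k').1 = 1)) ∨ (∃ e : {k : Fin N // k ≠ j ∧ dist (x N j) (x N k) ≤ a * (1 + 1 / 100)} ≃ {q : EuclideanSpace ℝ (Fin 3) // q ∈ Literature.Geometry.DiscreteGeometry.hcpKissingPattern}, ∀ k k' : {k : Fin N // k ≠ j ∧ dist (x N j) (x N k) ≤ a * (1 + 1 / 100)}, k ≠ k' → (dist (x N k.1) (x N k'.1) ≤ a * (1 + 1 / 100) ↔ dist (e k).1 (e k').1 = 1))))} : ℝ) / N) Filter.atTop (nhds 0)) → Literature.MathematicalPhysics.StatisticalMechanics.Crystallization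

/-- item stmt-AtomisticToContinuum-4145 · crux · rank 5 · closed · moot by None · by planner
why it might fail: Needs second-shell pricing: at p = 6 a 13-shell at the Tammes radius 1.0455 beats 12 contacts at first-shell level (13 x 0.0788 > 1); and the 1/100 spread must exceed the relaxed-hcp nearest-neighbour split (estimated 1-3e-3, uncertified) or the statement fails at every bulk atom.
sources: stmt-AtomisticToContinuum-0750, Hales2012, BlancLewin2015, Literature.Barriers.AtomisticToContinuum.IcosahedralClusters, Stillinger2001
[crux] LJ SOFT KISSING WITH TWO-SIDED STRAIN CONTROL (card B5(a), the p = 6 constant K1_6): there is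
a scale a > 0 such that along every sequence of Lennard-Jones ground states the fraction of atoms
NOT [at distance ≥ 0.99a from all others, exactly twelve within 1.01a, none in (1.01a, 1.26a)] tends
to 0. Stronger than the sibling item 0750 (which has no lower annulus bound, hence no strain
control); mechanism: second-shell pricing (card link-census-gauss-bonnet-3d) since one-shell
accounting fails at p = 6, plus elastic decay away from the o(N) defects and the N^(−1/3) Laplace
strain. [difficulty: open-problem] -/
@[route_item "route-AtomisticToContinuum-BrittleMieDescent"]
def LJSoftKissing : Prop :=
  ∃ a : ℝ, 0 < a ∧ ∀ x : (N : ℕ) → (Fin N → EuclideanSpace ℝ (Fin 3)), (∀ N, Literature.MathematicalPhysics.StatisticalMechanics.IsGroundState Literature.MathematicalPhysics.StatisticalMechanics.lennardJones (x N)) → Filter.Tendsto (fun N : ℕ => (Nat.card {i : Fin N // ¬ ((∀ j : Fin N, j ≠ i → a * (1 - 1 / 100) ≤ dist (x N i) (x N j) ∧ (dist (x N i) (x N j) ≤ a * (1 + 1 / 100) ∨ 63 / 50 * a ≤ dist (x N i) (x N j))) ∧ Nat.card {j : Fin N // j ≠ i ∧ dist (x N i) (x N j) ≤ a * (1 + 1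 / 100)} = 12)} : ℝ) / N) Filter.atTop (nhds 0)

/-- item stmt-AtomisticToContinuum-4146 · crux · rank 6 · closed · refuted by Summit.AtomisticToContinuum.Crystallization.Theorems.BrittleMieDescentEffectiveLocalHales_refuted @ 002241d41fff (refuter) · by planner
why it might fail: The threshold 1/100 is a bet: centred fcc/hcp shells flex at second order (jitterbug), and 12-point configurations with tolerance 1/100 but another contact graph may exist inside the slack of Hales's LP exclusions (Lemma 9) and of 2h0 = 2.52; Böröczky-Szabó eps-quasi-twelve constructions unread.
sources: Hales2012, KusnerKusnerLagariasShlosman2018, BoroczkySzabo2016, doi:10.1016/j.cam.2013.03.036, Literature.Barriers.AtomisticToContinuum.FlexibleKissingArrangements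
[crux] EFFECTIVE LOCAL HALES AT RADIUS 2 (card B5(b), the p = 6 constant η₀; pure metric geometry,
scale 1): if u ∈ S ⊂ ℝ³ and every point of S within 1.01 of u (u and its soft neighbours) is softly
twelve-kissed with tolerance 1/100 (all other points at distance ≥ 0.99, exactly twelve within 1.01,
none in (1.01, 1.26)), then the soft contact graph (pairs within 1.01) on the twelve neighbours of u
is isomorphic to the contact graph of the fcc pattern or of the hcp pattern (tree
`fccKissingPattern`/`hcpKissingPattern`, contacts at distance 1). The η → 0 version is
SoftLocalHales (support, compactness); this is its effectivisation at η = 1/100, a semialgebraic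
statement checkable Flyspeck-style by mining the margins of Hales's Lemma 9 exclusions and of Lemma
10's rigidity (tree KissingRigidity.lean, TameContactGraphs.lean). [difficulty: L] -/
@[route_item "route-AtomisticToContinuum-BrittleMieDescent"]
def EffectiveLocalHales : Prop :=
  ∀ (S : Set (EuclideanSpace ℝ (Fin 3))) (u : EuclideanSpace ℝ (Fin 3)), u ∈ S → (∀ v ∈ S, dist u v ≤ 1 + 1 / 100 → ((∀ w ∈ S, w ≠ v → 1 - 1 / 100 ≤ dist v w ∧ (dist v w ≤ 1 + 1 / 100 ∨ 63 / 50 ≤ dist v w)) ∧ {w ∈ S | w ≠ v ∧ dist v w ≤ 1 + 1 / 100}.ncard = 12)) → ((∃ e : {w : EuclideanSpace ℝ (Fin 3) // w ∈ S ∧ w ≠ u ∧ dist u w ≤ 1 + 1 / 100} ≃ {q : EuclideanSpace ℝ (Fin 3) // q ∈ Literature.Geometry.DiscreteGeometry.fccKissingPattern}, ∀ w w' : {w : EuclideanSpace ℝ (Fin 3) // w ∈ S ∧ w ≠ u ∧ dist u w ≤ 1 + 1 / 100}, w ≠ w' → (dist w.1 w'.1 ≤ 1 + 1 / 100 ↔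 dist (e w).1 (e w').1 = 1)) ∨ (∃ e : {w : EuclideanSpace ℝ (Fin 3) // w ∈ S ∧ w ≠ u ∧ dist u w ≤ 1 + 1 / 100} ≃ {q : EuclideanSpace ℝ (Fin 3) // q ∈ Literature.Geometry.DiscreteGeometry.hcpKissingPattern}, ∀ w w' : {w : EuclideanSpace ℝ (Fin 3) // w ∈ S ∧ w ≠ u ∧ dist u w ≤ 1 + 1 / 100}, w ≠ w' → (dist w.1 w'.1 ≤ 1 + 1 / 100 ↔ dist (e w).1 (e w').1 = 1)))

/-- item stmt-AtomisticToContinuum-3623 · support · rank 9 · closed · moot by None · by planner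
sources: BlancLewin2015, stmt-AtomisticToContinuum-3623, LennardJonesClusters.lean
[support] GROUND STATES ON THE LADDER EXIST AND ARE (1 − 2/q)-SEPARATED (card item S1, explicit
form): for q ≥ q₀, E(N) has minimisers for every N (binding inequalities, as
LennardJonesGroundStatesExist_holds) and every ground state of V_q has all distances ≥ 1 − 2/q
(removal argument: site energies ≤ 0 in a ground state; a pair at r ≤ 1 − 2/q contributes ≈ (e⁴/2 −
e²)/q ≈ 19.9/q against ≤ (#particles within ~1.3)·1/(2q) + tail of attraction, the count bounded
after an a-priori crude separation as in LennardJonesMinimalDistance_holds). The tree's LJ facts are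
q = 6 and qualitative; OneCentreDomination is stated at δ_q = 1 − 2/q, so the explicit constant is
needed. [difficulty: M] -/
@[route_item "route-AtomisticToContinuum-BrittleMieDescent"]
def LadderGroundStates : Prop :=
  ∃ q₀ : ℕ, ∀ q : ℕ, q₀ ≤ q → (∀ N : ℕ, ∃ x : Fin N → EuclideanSpace ℝ (Fin 3), Literature.MathematicalPhysics.StatisticalMechanics.IsGroundState (fun r : ℝ => 1 / (2 * (q : ℝ)) * r⁻¹ ^ (2 * q) - 1 / (q : ℝ) * r⁻¹ ^ q) x) ∧ (∀ (N : ℕ) (x : Fin N → EuclideanSpace ℝ (Fin 3)), Literature.MathematicalPhysics.StatisticalMechanics.IsGroundState (fun r : ℝ => 1 / (2 * (q : ℝ)) * r⁻¹ ^ (2 * q) - 1 / (q : ℝ) * r⁻¹ ^ q) x → ∀ i j : Fin N, i ≠ j → (1 - 2 / (q : ℝ)) ≤ dist (x i) (x j))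

/-- item stmt-AtomisticToContinuum-3624 · support · rank 9 · closed · moot by None · by planner
sources: FlatleyTheil2015, BlancLewin2015, stmt-AtomisticToContinuum-3624, arXiv:2204.12892, arXiv:2604.19239
[support] THE RUNG THEOREM (corollary of OneCentreDomination + LadderGroundStates +
ZeroDensityOfDefects + ExactificationCascade + DominationEnergyLimit): there is q₀ such that for all
q ≥ q₀ the (2q, q) potential V_q = r^{−2q}/(2q) − r^{−q}/q crystallizes in ℝ³ in both Blanc–Lewin
senses, onto hcp at its optimal scale — the first crystallization theorem in ℝ³ for a pure, smooth,
LJ-shaped PAIR potential (FlatleyTheil2015 Thm 1.1 needs a three-body term; Theil2006 / ELi2008 are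
d = 2; BeterminSamajTravenec2022 treat lattice energies only; status: BlancLewin2015 §2.3,
Kreutz–Ziereis arXiv:2604.19239 §1). q₀ (and later the first failing q_c of the pointwise bound) is
the route's computable measure of progress toward q = 6. Support (corollary) so that staffing keys
on the cruxes. [difficulty: L] -/
@[route_item "route-AtomisticToContinuum-BrittleMieDescent"]
def MieRung : Prop :=
  ∃ q₀ : ℕ, ∀ q : ℕ, q₀ ≤ q → Literature.MathematicalPhysics.StatisticalMechanics.HasPeriodicGroundStateEnergy (fun r : ℝ => 1 / (2 * (q : ℝ)) * r⁻¹ ^ (2 * q) - 1 / (q : ℝ) * r⁻¹ ^ q) 3 ∧ Literature.MathematicalPhysics.StatisticalMechanics.IsCrystallizing (fun r : ℝ => 1 / (2 * (q : ℝ)) * r⁻¹ ^ (2 * q) - 1 / (q : ℝ) * r⁻¹ ^ q) 3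

/-- item stmt-AtomisticToContinuum-4147 · support · rank 9 · closed · moot by None · by planner
sources: Hales2012, FlatleyTheil2015
[support] SOFT LOCAL HALES BY COMPACTNESS (card B2+(3); provable now): assuming the vendored
computer-assisted fact `Hales2012_contactGraphFccOrHcp` (Hales 2012 Thm 3 + Lemma 9, in graph form),
there is η₀ > 0 such that for all η ≤ η₀ the conclusion of EffectiveLocalHales holds with 1/100
replaced by η. Proof sketch: counterexamples with η_n → 0 have boundedly many points within 2.3 of u
(packing); extract a convergent subsequence; by the GAP hypothesis at u and at its neighbours the
limit shell, doubled, is in Hales's class 𝒱 (`IsKissingConfig`: twelve points on S²(2), mutual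
distances 2 or ≥ 2.52) — no L12 and no kissing-number theorem are needed — so its contact graph is
fcc/hcp, and soft contact graphs are eventually constant along the sequence. [difficulty:
provable-now] -/
@[route_item "route-AtomisticToContinuum-BrittleMieDescent"]
def SoftLocalHales : Prop :=
  Literature.Geometry.DiscreteGeometry.Hales2012_contactGraphFccOrHcp → ∃ η₀ : ℝ, 0 < η₀ ∧ ∀ η : ℝ, 0 < η → η ≤ η₀ → ∀ (S : Set (EuclideanSpace ℝ (Fin 3))) (u : EuclideanSpace ℝ (Fin 3)), u ∈ S → (∀ v ∈ S, dist u v ≤ 1 + η → ((∀ w ∈ S, w ≠ v → 1 - η ≤ dist v w ∧ (dist v w ≤ 1 + η ∨ 63 / 50 ≤ dist v w)) ∧ {w ∈ S | w ≠ v ∧ dist v w ≤ 1 + η}.ncard = 12)) → ((∃ e : {w : EuclideanSpace ℝ (Fin 3) // w ∈ S ∧ w ≠ u ∧ dist u w ≤ 1 + η} ≃ {q : EuclideanSpace ℝ (Fin 3) // q ∈ Literature.Geometry.DiscreteGeometry.fccKissingPattern}, ∀ w w' : {w : EuclideanSpace ℝ (Fin 3) // w ∈ S ∧ w ≠ u ∧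 dist u w ≤ 1 + η}, w ≠ w' → (dist w.1 w'.1 ≤ 1 + η ↔ dist (e w).1 (e w').1 = 1)) ∨ (∃ e : {w : EuclideanSpace ℝ (Fin 3) // w ∈ S ∧ w ≠ u ∧ dist u w ≤ 1 + η} ≃ {q : EuclideanSpace ℝ (Fin 3) // q ∈ Literature.Geometry.DiscreteGeometry.hcpKissingPattern}, ∀ w w' : {w : EuclideanSpace ℝ (Fin 3) // w ∈ S ∧ w ≠ u ∧ dist u w ≤ 1 + η}, w ≠ w' → (dist w.1 w'.1 ≤ 1 + η ↔ dist (e w).1 (e w').1 = 1)))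

/-- item stmt-AtomisticToContinuum-4148 · support · rank 9 · closed · moot by None · by planner
sources: HalesDSP2012, Hales2012
[support] SOFT LAYER PROPAGATION (qualitative local form of the PROVED
`HalesDSP_layerPackings_holds`): for every R ≥ 4 and δ > 0 there is η > 0 such that if every point
of S in the R-ball about c is softly twelve-kissed (tolerance η, gap 1.26) with an fcc/hcp soft
contact graph, then S in the R/2-ball is δ-close to a rigid-motion image of a Barlow stacking
`barlowStacking 1 √(2/3) s`, `IsHaggSeq s`. By compactness from the exact local statement
(LayerPropagation/LayerStackings.lean arguments are local). The effective octet-truss version rides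
with the rigidity cruxes (`--supports`). [difficulty: M] -/
@[route_item "route-AtomisticToContinuum-BrittleMieDescent"]
def SoftLayerPropagation : Prop :=
  ∀ R : ℝ, 4 ≤ R → ∀ δ : ℝ, 0 < δ → ∃ η : ℝ, 0 < η ∧ ∀ (S : Set (EuclideanSpace ℝ (Fin 3))) (c : EuclideanSpace ℝ (Fin 3)), (∀ v ∈ S, dist v c ≤ R → ((∀ w ∈ S, w ≠ v → 1 - η ≤ dist v w ∧ (dist v w ≤ 1 + η ∨ 63 / 50 ≤ dist v w)) ∧ {w ∈ S | w ≠ v ∧ dist v w ≤ 1 + η}.ncard = 12) ∧ ((∃ e : {w : EuclideanSpace ℝ (Fin 3) // w ∈ S ∧ w ≠ v ∧ dist v w ≤ 1 + η} ≃ {q : EuclideanSpace ℝ (Fin 3) // q ∈ Literature.Geometry.DiscreteGeometry.fccKissingPattern}, ∀ w w' : {w : EuclideanSpace ℝ (Fin 3) // w ∈ S ∧ w ≠ v ∧ dist v w ≤ 1 + η}, w ≠ w' → (dist w.1 w'.1 ≤ 1 + η ↔ dist (e w).1 (e w').1 = 1)) ∨ (∃ e : {w : EuclideanSpace ℝ (Fin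 3) // w ∈ S ∧ w ≠ v ∧ dist v w ≤ 1 + η} ≃ {q : EuclideanSpace ℝ (Fin 3) // q ∈ Literature.Geometry.DiscreteGeometry.hcpKissingPattern}, ∀ w w' : {w : EuclideanSpace ℝ (Fin 3) // w ∈ S ∧ w ≠ v ∧ dist v w ≤ 1 + η}, w ≠ w' → (dist w.1 w'.1 ≤ 1 + η ↔ dist (e w).1 (e w').1 = 1)))) → ∃ (s : ℤ → ℤ) (g : EuclideanSpace ℝ (Fin 3) ≃ᵃⁱ[ℝ] EuclideanSpace ℝ (Fin 3)), Literature.MathematicalPhysics.StatisticalMechanics.IsHaggSeq s ∧ ∀ v ∈ S, dist v c ≤ R / 2 → ∃ z ∈ Literature.MathematicalPhysics.StatisticalMechanics.barlowStacking 1 (Real.sqrt (2 / 3)) s, dist v (g z) ≤ δ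

/-- item stmt-AtomisticToContinuum-4149 · support · rank 9 · closed · moot by None · by planner
sources: Hales2012, FlatleyTheil2015
[support] glue for the rung, `SoftLocalHales → Hales2012_contactGraphFccOrHcp → LadderGroundStates →
MieSoftKissing → BrittleBarlowRigidity → MieRung`: SoftLocalHales gives η₀ under the Hales fact;
take η = min(η₀, η₁, 1/100); MieSoftKissing gives p₀(η); soft kissing is monotone in the tolerance
below the gap; atoms whose 7-ball contains a non-kissed atom number ≤ C·#(non-kissed) by packing
(separation from LadderGroundStates), hence o(N); SoftLocalHales supplies the shell graphs;
BrittleBarlowRigidity applies for p ≥ max(p₀(η), p₁, q₀) with existence from LadderGroundStates.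
[difficulty: provable-now] -/
@[route_item "route-AtomisticToContinuum-BrittleMieDescent"]
def RungAssembly : Prop :=
  SoftLocalHales → Literature.Geometry.DiscreteGeometry.Hales2012_contactGraphFccOrHcp → LadderGroundStates → MieSoftKissing → BrittleBarlowRigidity → MieRung

/-- item stmt-AtomisticToContinuum-4150 · assembly · rank 1 · closed · moot by None · by planner
sources: BlancLewin2015, Hales2012
[assembly] EffectiveLocalHales → LJSoftKissing → LJBarlowRigidity → Crystallization (the Literature
constant the sub-problem statement abbreviates). -/
@[route_item "route-AtomisticToContinuum-BrittleMieDescent"]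
def Assembly : Prop :=
  EffectiveLocalHales → LJSoftKissing → LJBarlowRigidity → Literature.MathematicalPhysics.StatisticalMechanics.Crystallization

end Summit.AtomisticToContinuum.Crystallization.Theses.BrittleMieDescent
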